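import Summits.BirchSwinnertonDyer.BirchSwinnertonDyer.Theorems.MordellShaFreeCutRoadsMeetFromPrint
import Summits.BirchSwinnertonDyer.BirchSwinnertonDyer.Theorems.CongruentShaFreeCutKatoReading31b
import Summits.BirchSwinnertonDyer.BirchSwinnertonDyer.Theorems.CongruentShaFreeCutKatoZetaRoadReadings
import Literature.NumberTheory.EllipticCurves.Kato2004.IwasawaCohomologyExistsProofs
import Literature.NumberTheory.EllipticCurves.Kato2004.LocPKernelRankOneProofs
import HarnessLib

set_option linter.dupNamespace false
set_option autoImplicit false

/-! # Route `MordellShaFreeCut` (rung S2b) — the kato-zeta line of record on stmt-BirchSwinnertonDyer-19160 needs Perrin-Riou's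
formula ONLY at Heegner fields of ODD discriminant: crux B ⟸ RI9 (+ the two `_holds` tree theorems) + `PRFormulaAtThreeH2`
RESTRICTED to `Odd d_K`

Cell `bsd-cn100`, prover seat `bsd-cn100-s2b-c3` (g8). Supports, does not close, stmt-BirchSwinnertonDyer-19160. THEOREMS ONLY.
The registered line `kato-zeta-perrin-riou` v1e reads crux B ⟸ `stub_refereedInputs` (RI9) + `stub_prFormulaAtThree :
PRFormulaAtThreeH2` (PR at EVERY imaginary quadratic Heegner field). Since the crux-B plumbing CHOOSES its Heegner field with
`d_K ≡ 1 (mod 8)` (`MordellShaFreeCutThreeAdicExistenceFromPrint.analyticRankOne_of_facts_of_heegnerNonTorsionOddDisc`, p489731)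
and [ABS] §10.1.3 runs field by field (`MordellShaFreeCutRoadsMeetFromPrint.heegnerNonTorsionOddDisc_of_prFormulaOddDisc_of_readings`,
p490456), the research stub is needed only at ODD `d_K` — a strictly WEAKER statement (calibration `prFormulaOddDisc_of_prFormulaH2`).
* `prFormulaOddDisc_of_prFormulaH2` — PR ⟹ PR-odd (drop a binder).
* `cruxB_of_namedFacts_of_prFormulaOddDisc` — crux B ⟸ nine named facts (conj 7/11 by `nonempty_iwasawaH1Data_holds` /
  `locP_kernel_isTorsion_of_rankOne_holds`) + PR-odd.
* `cruxB_of_refereedInputs_of_prFormulaOddDisc` — the same over the v1e 9-conjunct bundle TOKEN FOR TOKEN (a v1e′ composition).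
HONEST FRAMING: CONDITIONAL compositions; PR at 3 (odd d_K or not), crux B, Sylvester, BSD all OPEN. PARTITION: none — RANK axis.
[cite: AlpogeBhargavaShnidman2022, App. A Thm. 10.1, Thm. 10.8, §10.1.3 (pp. 33–34)] [cite: HoffsteinLuo1997, Theorem (§1)] -/

noncomputable section

open scoped NumberField Classical

open PowerSeries WeierstrassCurve NumberField IsDedekindDomain Field Literature.NumberTheory.EllipticCurves
  Literature.NumberTheory.EllipticCurves.ModularForms Literature.NumberTheory.QuadraticFields
  Literature.NumberTheory.EllipticCurves.Castella2018 Literature.NumberTheory.EllipticCurves.Kato2004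
  Literature.NumberTheory.EllipticCurves.Rank1Residual
open Literature.NumberTheory.GaloisRepresentations Literature.NumberTheory.GaloisCohomology
open Summit.BirchSwinnertonDyer.Rank1Residual.Additive (KatoDescentDatum)
open Summit.BirchSwinnertonDyer.BirchSwinnertonDyer.Theses.MordellShaFreeCut (AnalyticRankOneOfRankOneFiniteShaThree)
open Summit.BirchSwinnertonDyer.BirchSwinnertonDyer.Theorems.CongruentShaFreeCutKatoDescentDatumOfH2
open Summit.BirchSwinnertonDyer.BirchSwinnertonDyer.Theorems.MordellShaFreeCutKatoZetaRoadPinnedH2 (PRFormulaAtThreeH2)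
open Summit.BirchSwinnertonDyer.BirchSwinnertonDyer.Theorems.MordellShaFreeCutThreeAdicExistenceFromPrint
  (analyticRankOne_of_facts_of_heegnerNonTorsionOddDisc)
open Summit.BirchSwinnertonDyer.BirchSwinnertonDyer.Theorems.MordellShaFreeCutRoadsMeetFromPrint
  (heegnerNonTorsionOddDisc_of_prFormulaOddDisc_of_readings)

namespace Summit.BirchSwinnertonDyer.BirchSwinnertonDyer.Theorems.MordellShaFreeCutKatoZetaRoadOddDiscCensus

/-- **PR ⟹ PR-odd**: Perrin-Riou's formula at every Heegner field implies it at the Heegner fields of ODD discriminant (drop the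
binder). Calibration: the odd-`d_K` statement is WEAKER. [folklore] -/
theorem prFormulaOddDisc_of_prFormulaH2 (hPR : PRFormulaAtThreeH2) :
    ∀ (W : WeierstrassCurve ℚ) [W.IsElliptic] [W.IsGloballyMinimal]
      [ContinuousSMul ℤ_[3] (W.tateModule 3)], W.j = 0 →
      ∀ (K : Type) [Field K] [NumberField K] (N : ℕ) [NeZero N],
        W.conductorNorm ℤ = N → IsImaginaryQuadratic K → Odd (NumberField.discr K) →
          SatisfiesHeegnerHypothesis N K → SatisfiesHeegnerHypothesis 3 K →
            (W.quadraticTwist (NumberField.discr K : ℚ)).entireLFunction 1 ≠ 0 →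
        ∀ (ι : K →+* ℚ_[3]) (P : (W.baseChange K).toAffine.Point), IsHeegnerPoint N W K P →
          W.entireLFunction 1 = 0 →
        ∀ (D : KatoDescentDatum 3) (pin : KatoDescentDatumPinH2 W 3 D),
          (∃ a b : ℕ,
            Ideal.span {((3 : ℕ) : IwasawaAlgebra 3) ^ a} * Module.charIdeal (IwasawaAlgebra 3) D.H2 =
              Ideal.span {((3 : ℕ) : IwasawaAlgebra 3) ^ b} *
                Module.charIdeal (IwasawaAlgebra 3) (D.H ⧸ (IwasawaAlgebra 3) ∙ D.z)) →
          ∃ c : ℚ_[3], c ≠ 0 ∧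
            HasLocPKummerLog W 3 pin.katoClass (c * padicLogOmega W 3 ι P ^ 2) :=
  fun W _ _ _ hj K _ _ N _ hN hK _ hHN hH3 hLtw ι P hP hL1 D pin hMC ↦
    hPR W hj K N hN hK hHN hH3 hLtw ι P hP hL1 D pin hMC

/-- **Crux B ⟸ nine named facts + Perrin-Riou's formula at ODD `d_K` only** (six refereed theorems; `nonempty_iwasawaH2Data`,
`thm12_4`, `finite_descentCokernel_of_rankOne`; conj 7/11 of the old bundle by the tree theorems `nonempty_iwasawaH1Data_holds` /
`locP_kernel_isTorsion_of_rankOne_holds`): the v2 composition choosing `d_K ≡ 1 (mod 8)` ∘ [ABS] §10.1.3 at odd `d_K` with the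
readings fed by name. CONDITIONAL; closes nothing. [cite: AlpogeBhargavaShnidman2022, App. A Thm. 10.1 and §10.1.3 (pp. 33–34)]
[cite: Kato2004Asterisque, Thm. 12.4 (p. 221), (14.9.3) (p. 240), §14.14 (p. 243), Cor. 14.3] -/
theorem cruxB_of_namedFacts_of_prFormulaOddDisc
    (hpar : ∀ (W : WeierstrassCurve ℚ) [W.IsElliptic] (p : ℕ) [Fact p.Prime], p_parity W p)
    (hmod : ModularForms.exists_isNewformOf) (hHL : HoffsteinLuo1997_exists_twist_L_one_ne_zero)
    (hKato : ∀ (W : WeierstrassCurve ℚ) [W.IsElliptic] (p : ℕ) [Fact p.Prime],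
      kato_finite_of_L_one_ne_zero W p)
    (hHP : ∀ (W : WeierstrassCurve ℚ) (K : Type) [Field K] [NumberField K],
      exists_isHeegnerPoint W K)
    (hGZ : ∀ (W : WeierstrassCurve ℚ) (N : ℕ) [NeZero N] (K : Type) [Field K] [NumberField K],
      analyticRankEK_eq_one_iff_heegner_nonTorsion W N K)
    (h2 : nonempty_iwasawaH2Data) (h12 : thm12_4) (h31 : finite_descentCokernel_of_rankOne)
    (hPR : ∀ (W : WeierstrassCurve ℚ) [W.IsElliptic] [W.IsGloballyMinimal]
      [ContinuousSMul ℤ_[3] (W.tateModule 3)], W.j = 0 →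
      ∀ (K : Type) [Field K] [NumberField K] (N : ℕ) [NeZero N],
        W.conductorNorm ℤ = N → IsImaginaryQuadratic K → Odd (NumberField.discr K) →
          SatisfiesHeegnerHypothesis N K → SatisfiesHeegnerHypothesis 3 K →
            (W.quadraticTwist (NumberField.discr K : ℚ)).entireLFunction 1 ≠ 0 →
        ∀ (ι : K →+* ℚ_[3]) (P : (W.baseChange K).toAffine.Point), IsHeegnerPoint N W K P →
          W.entireLFunction 1 = 0 →
        ∀ (D : KatoDescentDatum 3) (pin : KatoDescentDatumPinH2 W 3 D),
          (∃ a b : ℕ,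
            Ideal.span {((3 : ℕ) : IwasawaAlgebra 3) ^ a} * Module.charIdeal (IwasawaAlgebra 3) D.H2 =
              Ideal.span {((3 : ℕ) : IwasawaAlgebra 3) ^ b} *
                Module.charIdeal (IwasawaAlgebra 3) (D.H ⧸ (IwasawaAlgebra 3) ∙ D.z)) →
          ∃ c : ℚ_[3], c ≠ 0 ∧
            HasLocPKummerLog W 3 pin.katoClass (c * padicLogOmega W 3 ι P ^ 2)) :
    AnalyticRankOneOfRankOneFiniteShaThree :=
  analyticRankOne_of_facts_of_heegnerNonTorsionOddDisc hpar hmod hHL hKato hHP hGZ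
    (heegnerNonTorsionOddDisc_of_prFormulaOddDisc_of_readings hKato
      (CongruentShaFreeCutKatoZetaRoadReadings.readingRK_jZero_three_of_facts nonempty_iwasawaH1Data_holds h2 h12)
      (fun _ _ _ _ D _ hD hrank hsha ↦ finite_coinvariants_H2_of_rankOne_of_nonempty_pinH2 h31 D hD hrank hsha)
      (CongruentShaFreeCutKatoReading31b.reading31b_three_of_fact locP_kernel_isTorsion_of_rankOne_holds) hPR)

/-- **The v1e bundle TOKEN FOR TOKEN + PR at odd `d_K` ⟹ crux B** (a ready composition for a v1e′ whose research stub is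
Perrin-Riou's formula restricted to the Heegner fields the line actually uses). CONDITIONAL; closes nothing.
[cite: AlpogeBhargavaShnidman2022, App. A Thm. 10.1 and §10.1.3 (pp. 33–34)] -/
theorem cruxB_of_refereedInputs_of_prFormulaOddDisc
    (RI : (∀ (W : WeierstrassCurve ℚ) [W.IsElliptic] (p : ℕ) [Fact p.Prime], p_parity W p) ∧
      ModularForms.exists_isNewformOf ∧
      HoffsteinLuo1997_exists_twist_L_one_ne_zero ∧
      (∀ (W : WeierstrassCurve ℚ) [W.IsElliptic] (p : ℕ) [Fact p.Prime],
        kato_finite_of_L_one_ne_zero W p) ∧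
      (∀ (W : WeierstrassCurve ℚ) (K : Type) [Field K] [NumberField K], exists_isHeegnerPoint W K) ∧
      (∀ (W : WeierstrassCurve ℚ) (N : ℕ) [NeZero N] (K : Type) [Field K] [NumberField K],
        analyticRankEK_eq_one_iff_heegner_nonTorsion W N K) ∧
      nonempty_iwasawaH2Data ∧ thm12_4 ∧ finite_descentCokernel_of_rankOne)
    (hPR : ∀ (W : WeierstrassCurve ℚ) [W.IsElliptic] [W.IsGloballyMinimal]
      [ContinuousSMul ℤ_[3] (W.tateModule 3)], W.j = 0 →
      ∀ (K : Type) [Field K] [NumberField K] (N : ℕ) [NeZero N],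
        W.conductorNorm ℤ = N → IsImaginaryQuadratic K → Odd (NumberField.discr K) →
          SatisfiesHeegnerHypothesis N K → SatisfiesHeegnerHypothesis 3 K →
            (W.quadraticTwist (NumberField.discr K : ℚ)).entireLFunction 1 ≠ 0 →
        ∀ (ι : K →+* ℚ_[3]) (P : (W.baseChange K).toAffine.Point), IsHeegnerPoint N W K P →
          W.entireLFunction 1 = 0 →
        ∀ (D : KatoDescentDatum 3) (pin : KatoDescentDatumPinH2 W 3 D),
          (∃ a b : ℕ,
            Ideal.span {((3 : ℕ) : IwasawaAlgebra 3) ^ a} * Module.charIdeal (IwasawaAlgebra 3) D.H2 =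
              Ideal.span {((3 : ℕ) : IwasawaAlgebra 3) ^ b} *
                Module.charIdeal (IwasawaAlgebra 3) (D.H ⧸ (IwasawaAlgebra 3) ∙ D.z)) →
          ∃ c : ℚ_[3], c ≠ 0 ∧
            HasLocPKummerLog W 3 pin.katoClass (c * padicLogOmega W 3 ι P ^ 2)) :
    AnalyticRankOneOfRankOneFiniteShaThree :=
  cruxB_of_namedFacts_of_prFormulaOddDisc RI.1 RI.2.1 RI.2.2.1 RI.2.2.2.1 RI.2.2.2.2.1 RI.2.2.2.2.2.1
    RI.2.2.2.2.2.2.1 RI.2.2.2.2.2.2.2.1 RI.2.2.2.2.2.2.2.2 hPR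

end Summit.BirchSwinnertonDyer.BirchSwinnertonDyer.Theorems.MordellShaFreeCutKatoZetaRoadOddDiscCensus

end
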